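import Literature.Geometry.Kaehler.ComplexTorusTotalLieAlgebraRealJordanLefschetzPair
import Literature.Algebra.Lie.JordanLefschetzPairDegreeZero
import Literature.Algebra.Lie.LefschetzModuleJordanType
import Literature.GroupTheory.FiniteAbelian.AlternatingPairing
import HarnessLib

/-!
# Looijenga–Lunts (2.6)/(3.3), the excluded cases: `(𝔰𝔬(V ⊕ V^*), u)` is a Lefschetz pair ONLY IF `dim V` is even — `u` simple forces a symplectic form on `V` — and, on complex tori, only if `g ≥ 2`

Topic `Literature/Geometry/Kaehler` (namespaces `Literature.Algebra.Lie`, `Literature.LinearAlgebra.Alternating`,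
`Literature.Geometry.Kaehler.ComplexTorus`).  Lane `lit-hodgefound` (Track 2 foundations library), skeleton seat
`lit-hodgefound-skel-1` (generation 52), row **A1-213** of `run/shared/lean/pub/lit-hodgefound/SKELETON.md`; the
"only if" companion of row A1-211 (`isJordanLefschetzPair_so`: `(𝔰𝔬(V ⊕ V^*), u)` IS a Jordan–Lefschetz pair for
`dim_ℂ V = g ≥ 2`, transported from `𝔤_tot(X; ℝ)`) and of row A1-204 (Lagrangian splittings, `dim L = 2k`, `k ≥ 2`).
Looijenga–Lunts' list (2.6) carries the bound "`(D_{2m}, A_{2m-1})` (`m ≥ 2`)", and its proof explains what is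
excluded: "in case `D_{2l+1}` any end of the Dynkin diagram […] These additional possibilities disappear if we want
`h` to be a simple element (that is, `h = [e,f]` for certain `e ∈ 𝔤_2` and `f ∈ 𝔤_{-2}`)"; in the model (3.1)
`(𝔰𝔬(V ⊕ V^*), u)`, `u = (-1_V, 1_{V^*})`, this file PROVES the two exclusions:

* **`dim V` odd (`D_{2l+1}`): `u` is not even a simple element** — an `𝔰𝔩₂`-triple `(e, u, f)` in `𝔰𝔬(V ⊕ V^*)`
  has `e ∈ 𝔤_2` a block `C : V → V^*`, `f ∈ 𝔤_{-2}` a block `B : V^* → V`, `[e, f] = u` says `BC = 1_V`, and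
  skewness makes `(x, y) ↦ (Cx)(y)` a non-degenerate ALTERNATING form on `V`, so `dim V` is even
  (**`even_finrank_of_isSl2Triple_gradingElement`**; the tree's `even_finrank_of_isAlt_of_nondegenerate`) — this is
  the printed mechanism "the `d_i`'s must all be even in the orthogonal cases with odd parity" (§1, after (1.16):
  `V ⊕ V^*` has the odd `u`-degrees `∓1` with `d_0 = dim V`); hence **`not_isLefschetzPair_so_of_odd`**;
* **`dim_ℂ V = 1` (`m = 1`, the elliptic curve, `𝔰𝔬(V ⊕ V^*) = 𝔰𝔬(2,2)`): not a Lefschetz pair** — a Lefschetz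
  triple `(𝔰𝔬(V ⊕ V^*), u, 𝔞)` would be Jordan–Lefschetz (`𝔤_4(u) = 0`, rows A1-109/A1-211), and a Jordan–Lefschetz
  pair with `dim 𝔤_{±2} ≤ 1` has `dim 𝔤 ≤ 3` (`𝔤 = 𝔤_{-2} ⊕ 𝔤_0 ⊕ 𝔤_2` with `𝔤_0 = span [𝔤_2, 𝔤_{-2}]`, rows
  A1-84/A1-197: **`IsJordanLefschetzPair.finrank_le_three`**), whereas `dim_ℝ 𝔰𝔬(V ⊕ V^*) = 6` (row A1-73
  `finrank_so`) and `dim 𝔰𝔬(V ⊕ V^*)_{±2} = dim ∧²V^{(*)} = 1` (**`finrank_adDegree_two_so_le_one`**,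
  **`finrank_adDegree_neg_two_so_le_one`**): `𝔤_2 ⊕ 𝔤_{-2}` generates only the `𝔰𝔩₂ = 𝔤_tot(X; ℝ) ⊊ 𝔰𝔬(2,2)` of
  row A1-43 (**`not_isLefschetzPair_so_of_finrank_eq_one`**); with row A1-211, **`isJordanLefschetzPair_so_iff`:
  `(𝔰𝔬(V ⊕ V^*), u)` is a Jordan–Lefschetz pair iff `g ≥ 2`** (`isLefschetzPair_so_iff` likewise).

THEOREMS ONLY (no definition, no named fact, no `sorry`; net debt `0`); no local instance attribute (the `𝔰𝔩₂`
relations are read off at the level of `End(V ⊕ V^*)` through `Subtype.val`).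

## Source, VERBATIM

E. Looijenga, V. A. Lunts, *A Lie algebra attached to a projective variety*, Invent. Math. **129** (1997) 361–412 (held
TeX `paper:arxiv-alg-geom_9604014`): §2 (2.6) Corollary, p. 10 L20–L29: "Then the pair `(B, B - {β})` is of the
following type: `(A_{2m-1}, A_{m-1}+A_{m-1})` (`m ≥ 1`), `(B_m, B_{m-1})` (`m ≥ 2`), `(C_m, A_{m-1})` (`m ≥ 2`),
`(D_m, D_{m-1})` (`m ≥ 5`), `(D_{2m}, A_{2m-1})` (`m ≥ 2`) or `(E_7, E_6)`.  Conversely, every item of this list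
determines an isomorphism class of Jordan–Lefschetz pairs."; proof, L30–L37: "The pairs `(B, β)` with the property
of the previous lemma are those in this list plus the following: in case `A_l` we can take `l` and `β` arbitrary, in
case `D_{2l+1}` any end of the Dynkin diagram, and `B` of type `E_6` with `β` the end of the branch of length `3`.
These addional possibilities disappear if we want `h` to be a simple element (that is, `h = [e,f]` for certain
`e ∈ 𝔤_2` and `f ∈ 𝔤_{-2}`): for the classical cases `A_l` and `D_{2l+1}` this follows from the discussion
following 1.16)"; §1 p. 8 L78–L83: "an finite dimensional `𝔰𝔩(2)`-representation of even parity always admits a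
nondegenerate invariant symmetric form, whereas it admits a nondegenerate invariant skew-symmetric form if and only if
all multiplicities are even. In the case of odd parity it is just the other way around.", L96–L98: "By the remark
above, the `d_i`'s must all be even in the orthogonal cases with odd parity"; §3 (3.1) p. 13 L46–L47: "The
semi-simple element `u := (-1_V, +1_{V^*}) ∈ 𝔰𝔬(V ⊕ V^*)` defines a grading of the latter with degrees `2`, `0`
and `-2`.", L49–L57 (`ψ_0 : 𝔤𝔩(V^*) → 𝔰𝔬(V ⊕ V^*)_0`, `ψ_2 : ∧²V^* → 𝔰𝔬(V ⊕ V^*)_2`,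
`ψ_{-2} : ∧²V → 𝔰𝔬(V ⊕ V^*)_{-2}`); (3.3) p. 13 L110–L112: "There is a natural identification
`(𝔤_tot(X;ℝ), h) ≅ (𝔰𝔬(V^* ⊕ V), u)`; this is a real form of the case `(D_{2n}, A_{2n-1})`."; §1 p. 7 L54–L78
(Lefschetz triple: "a simple element `h ∈ 𝔤` […] (ii) `𝔤` is as a Lie algebra generated by `𝔞` and the image of
`f`"); §3 proof of (3.6) p. 14 L78–L79 ("For a Jordan pair `(𝔤, h)`, `[𝔤_2, 𝔤_{-2}]` generates `𝔤_0`").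

## Contents (all proved)

* §1 (abstract, `K` of characteristic `0`, `𝔤` finite-dimensional) `IsJordanLefschetzPair.adDegree_zero_le_span_lie`,
  **`IsJordanLefschetzPair.finrank_le_three`** (`dim 𝔤_{±2} ≤ 1 ⟹ dim 𝔤 ≤ 3`);
* §2 (real `V`) the `u`-degrees of `𝔤𝔩(V ⊕ V^*)` in blocks: `smul_blocks_eq_zero_of_lie_gradingElement_eq_smul`
  (`cA = 0`, `(2 - c)C = 0`, `(c + 2)B = 0`, `cD = 0`), the degree-`±2` block shapes
  (`fst_apply_inl_eq_zero_…`, `apply_inr_eq_zero_…`, `apply_inl_eq_zero_…`, `snd_apply_inr_eq_zero_…`), and skewness of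
  the off-diagonal blocks of `T ∈ 𝔰𝔬(V ⊕ V^*)` (`snd_apply_inl_apply_comm_of_mem_so`, `apply_fst_apply_inr_comm_of_mem_so`);
* §3 (real `V`, finite-dimensional) **`even_finrank_of_isSl2Triple_gradingElement`**,
  `even_finrank_of_isSimpleElement_gradingElement`, **`not_isLefschetzPair_so_of_odd`**, `not_isJordanLefschetzPair_so_of_odd`;
* §4 (complex `V = E`, `dim_ℂ E = 1`) `finrank_adDegree_two_so_le_one`, `finrank_adDegree_neg_two_so_le_one`,
  **`not_isLefschetzPair_so_of_finrank_eq_one`**, `not_isJordanLefschetzPair_so_of_finrank_eq_one`,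
  **`isJordanLefschetzPair_so_iff`**, `isLefschetzPair_so_iff` (`⟺ 2 ≤ dim_ℂ E`, with row A1-211).

## SCOPE (what is NOT formalised here)

(a) The converse for a REAL `V` of even dimension `≥ 4` (`(𝔰𝔬(V ⊕ V^*), u)` Jordan–Lefschetz) is row A1-204
(`LagrangianSplittingJordanLefschetzPair`, any field of characteristic `0`) / row A1-211 (complex `V`), not restated;
the real plane `dim_ℝ V = 2` is treated only through a complex line `E` (`finrank_so` is typed over `ℂ`).
-- TODO(general form): `dim_ℝ V = 2` for a real normed plane `V`.
(b) The root-theoretic statements (2.4)–(2.6) themselves (`B_2` a singleton, the Dynkin-diagram list) are not formalised.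
(c) Nothing here concerns the Hodge conjecture.

## References

* [LooijengaLunts1997] E. Looijenga, V. A. Lunts, *A Lie algebra attached to a projective variety*, Invent. Math. 129
  (1997) 361–412; arXiv:alg-geom/9604014. §1 p. 7, p. 8 (after (1.16)); §2 (2.6) p. 10; §3 (3.1), (3.3) p. 13, (3.6) p. 14
  (held `paper:arxiv-alg-geom_9604014`).
-/

/-! ### §1 Abstract: a Jordan–Lefschetz pair with `dim 𝔤_{±2} ≤ 1` has `dim 𝔤 ≤ 3` -/

namespace Literature.Algebra.Lie

open Module

variable {K : Type*} {L : Type*} [Field K] [CharZero K] [LieRing L] [LieAlgebra K L] [FiniteDimensional K L] {h : L}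

omit [CharZero K] [FiniteDimensional K L] in
/-- `dim (K ∙ v) ≤ 1`. [folklore] -/
private theorem finrank_span_singleton_le_one (v : L) : finrank K (K ∙ v) ≤ 1 := by
  by_cases hv : v = 0
  · subst hv
    rw [Submodule.span_zero_singleton, finrank_bot]
    exact zero_le_one
  · rw [finrank_span_singleton hv]

/-- For a Jordan–Lefschetz pair with `𝔤_2 ⊆ K e₀` and `𝔤_{-2} ⊆ K f₀`: `𝔤_0 ⊆ K [e₀, f₀]` (row A1-197:
`𝔤_0` is spanned by `[𝔤_2, 𝔤_{-2}]`). [cite: LooijengaLunts1997, §3 proof of (3.6) p. 14 L78–L79 ("for a Jordan pair (𝔤, h), [𝔤_2, 𝔤_{-2}] generates 𝔤_0")] -/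
theorem IsJordanLefschetzPair.adDegree_zero_le_span_lie (J : IsJordanLefschetzPair K h) {e₀ f₀ : L}
    (h2 : adDegree K h 2 ≤ K ∙ e₀) (hn2 : adDegree K h (-2) ≤ K ∙ f₀) : adDegree K h 0 ≤ K ∙ ⁅e₀, f₀⁆ := by
  rw [← J.span_lie_eq_adDegree_zero, Submodule.span_le]
  rintro z ⟨x, hx, y, hy, rfl⟩
  obtain ⟨a, rfl⟩ := Submodule.mem_span_singleton.1 (h2 hx)
  obtain ⟨b, rfl⟩ := Submodule.mem_span_singleton.1 (hn2 hy)
  rw [SetLike.mem_coe, smul_lie, lie_smul, smul_smul]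
  exact Submodule.smul_mem _ _ (Submodule.mem_span_singleton_self _)

/-- **A Jordan–Lefschetz pair with `dim 𝔤_2 ≤ 1` and `dim 𝔤_{-2} ≤ 1` has `dim 𝔤 ≤ 3`**
(`𝔤 = 𝔤_{-2} ⊕ 𝔤_0 ⊕ 𝔤_2`, (2.2), with `𝔤_0 = span [𝔤_2, 𝔤_{-2}]` of dimension `≤ 1`).
[cite: LooijengaLunts1997, §2 (2.2) p. 9 L112–L119, §3 proof of (3.6) p. 14 L78–L79] -/
theorem IsJordanLefschetzPair.finrank_le_three (J : IsJordanLefschetzPair K h)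
    (h2 : finrank K (adDegree K h 2) ≤ 1) (hn2 : finrank K (adDegree K h (-2)) ≤ 1) : finrank K L ≤ 3 := by
  obtain ⟨e₀, he₀⟩ := finrank_le_one_iff.1 h2
  obtain ⟨f₀, hf₀⟩ := finrank_le_one_iff.1 hn2
  have h2' : adDegree K h 2 ≤ K ∙ (e₀ : L) := fun x hx ↦ by
    obtain ⟨c, hc⟩ := he₀ ⟨x, hx⟩
    exact Submodule.mem_span_singleton.2 ⟨c, by rw [← Submodule.coe_smul, hc]⟩
  have hn2' : adDegree K h (-2) ≤ K ∙ (f₀ : L) := fun x hx ↦ by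
    obtain ⟨c, hc⟩ := hf₀ ⟨x, hx⟩
    exact Submodule.mem_span_singleton.2 ⟨c, by rw [← Submodule.coe_smul, hc]⟩
  have h0 : finrank K (adDegree K h 0) ≤ 1 :=
    (Submodule.finrank_mono (J.adDegree_zero_le_span_lie h2' hn2')).trans (finrank_span_singleton_le_one _)
  have key : finrank K (⊤ : Submodule K L) ≤ 3 := by
    rw [← J.sup_adDegree_eq_top]
    calc finrank K ↥(adDegree K h (-2) ⊔ adDegree K h 0 ⊔ adDegree K h 2)
        ≤ finrank K ↥(adDegree K h (-2) ⊔ adDegree K h 0) + finrank K (adDegree K h 2) :=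
          Submodule.finrank_add_le_finrank_add_finrank _ _
      _ ≤ (finrank K (adDegree K h (-2)) + finrank K (adDegree K h 0)) + finrank K (adDegree K h 2) := by
          gcongr
          exact Submodule.finrank_add_le_finrank_add_finrank _ _
      _ ≤ (1 + 1) + 1 := by gcongr
  rwa [finrank_top] at key

end Literature.Algebra.Lie

/-! ### §2 The `u`-graded pieces of `𝔤𝔩(V ⊕ V^*)` in blocks, and skewness -/

namespace Literature.LinearAlgebra.Alternating

open Module Function Literature.Algebra.Lie

variable (V : Type*) [NormedAddCommGroup V] [NormedSpace ℝ V]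

variable {V} in
/-- **The `u`-degree equations in blocks.**  Writing `T(x, 0) = (Ax, Cx)` and `T(0, ξ) = (Bξ, Dξ)`, the relation
`[u, T] = cT` (`u = (-1_V, 1_{V^*})`) reads `cA = 0`, `(2 - c)C = 0`, `(c + 2)B = 0`, `cD = 0`: so `A, D` have
degree `0`, `C` degree `2`, `B` degree `-2` ("`A`, `B` and `C` parametrize the summands of degree `0`, `-2` and `2`").
[cite: LooijengaLunts1997, §3 (3.1) p. 13 L46–L47 ("u := (−1_V, +1_{V^*}) ∈ 𝔰𝔬(V ⊕ V^*) defines a grading of the latter with degrees 2, 0 and −2"), §3 p. 15 L104–L106] -/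
theorem smul_blocks_eq_zero_of_lie_gradingElement_eq_smul {T : Module.End ℝ (sumDual V)} {c : ℝ}
    (h : ⁅gradingElement V, T⁆ = c • T) :
    (∀ x : V, c • (T (x, 0)).1 = 0) ∧ (∀ x y : V, (2 - c) * (T (x, 0)).2 y = 0) ∧
      (∀ ξ : V →L[ℝ] ℝ, (c + 2) • (T (0, ξ)).1 = 0) ∧ (∀ (ξ : V →L[ℝ] ℝ) (y : V), c * (T (0, ξ)).2 y = 0) := by
  have key : ∀ v, gradingElement V (T v) - T (gradingElement V v) = c • T v := fun v ↦ by
    have hv := LinearMap.congr_fun h v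
    rwa [Ring.lie_def, LinearMap.sub_apply, Module.End.mul_apply, Module.End.mul_apply, LinearMap.smul_apply] at hv
  have hL : ∀ x : V, c • (T (x, 0)).1 = 0 ∧ ∀ y : V, (2 - c) * (T (x, 0)).2 y = 0 := fun x ↦ by
    have hk := key (x, 0)
    have hneg : T ((-x : V), (0 : V →L[ℝ] ℝ)) = -T (x, 0) := by rw [← map_neg, Prod.neg_mk, neg_zero]
    rw [gradingElement_apply, gradingElement_apply, hneg, sub_neg_eq_add] at hk
    obtain ⟨hk1, hk2⟩ := Prod.ext_iff.1 hk
    simp only [Prod.fst_add, Prod.snd_add, Prod.smul_fst, Prod.smul_snd, neg_add_cancel] at hk1 hk2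
    refine ⟨hk1.symm, fun y ↦ ?_⟩
    have hy := DFunLike.congr_fun hk2 y
    simp only [add_apply, smul_apply, smul_eq_mul] at hy
    linear_combination hy
  have hR : ∀ ξ : V →L[ℝ] ℝ, (c + 2) • (T (0, ξ)).1 = 0 ∧ ∀ y : V, c * (T (0, ξ)).2 y = 0 := fun ξ ↦ by
    have hk := key (0, ξ)
    rw [gradingElement_apply, gradingElement_apply, neg_zero] at hk
    obtain ⟨hk1, hk2⟩ := Prod.ext_iff.1 hk
    simp only [Prod.fst_sub, Prod.snd_sub, Prod.smul_fst, Prod.smul_snd, sub_self] at hk1 hk2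
    refine ⟨?_, fun y ↦ ?_⟩
    · rw [add_smul, two_smul, ← hk1]
      abel
    · have hy := DFunLike.congr_fun hk2 y
      simp only [zero_apply, smul_apply, smul_eq_mul] at hy
      exact hy.symm
  exact ⟨fun x ↦ (hL x).1, fun x ↦ (hL x).2, fun ξ ↦ (hR ξ).1, fun ξ ↦ (hR ξ).2⟩

variable {V} in
/-- Degree `2`: `T(x, 0) ∈ 0 ⊕ V^*` (the `V → V`-block vanishes). [cite: LooijengaLunts1997, §3 (3.1) p. 13 L46–L47] -/
theorem fst_apply_inl_eq_zero_of_lie_gradingElement_eq_two_smul {T : Module.End ℝ (sumDual V)}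
    (h : ⁅gradingElement V, T⁆ = (2 : ℝ) • T) (x : V) : (T (x, 0)).1 = 0 := by
  have h1 := (smul_blocks_eq_zero_of_lie_gradingElement_eq_smul h).1 x
  rwa [smul_eq_zero_iff_right two_ne_zero] at h1

variable {V} in
/-- Degree `2`: `T(0, ξ) = 0` (the `V^* → V ⊕ V^*`-blocks vanish). [cite: LooijengaLunts1997, §3 (3.1) p. 13 L46–L47] -/
theorem apply_inr_eq_zero_of_lie_gradingElement_eq_two_smul {T : Module.End ℝ (sumDual V)}
    (h : ⁅gradingElement V, T⁆ = (2 : ℝ) • T) (ξ : V →L[ℝ] ℝ) : T (0, ξ) = 0 := by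
  obtain ⟨-, -, h3, h4⟩ := smul_blocks_eq_zero_of_lie_gradingElement_eq_smul h
  have h3' := h3 ξ
  rw [smul_eq_zero_iff_right (by norm_num)] at h3'
  refine Prod.ext h3' (ContinuousLinearMap.ext fun y ↦ ?_)
  have h4' := h4 ξ y
  rw [mul_eq_zero_iff_left two_ne_zero] at h4'
  rw [h4', Prod.snd_zero, zero_apply]

variable {V} in
/-- Degree `-2`: `T(x, 0) = 0`. [cite: LooijengaLunts1997, §3 (3.1) p. 13 L46–L47] -/
theorem apply_inl_eq_zero_of_lie_gradingElement_eq_neg_two_smul {T : Module.End ℝ (sumDual V)}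
    (h : ⁅gradingElement V, T⁆ = (-2 : ℝ) • T) (x : V) : T (x, 0) = 0 := by
  obtain ⟨h1, h2, -, -⟩ := smul_blocks_eq_zero_of_lie_gradingElement_eq_smul h
  have h1' := h1 x
  rw [smul_eq_zero_iff_right (by norm_num)] at h1'
  refine Prod.ext h1' (ContinuousLinearMap.ext fun y ↦ ?_)
  have h2' := h2 x y
  rw [mul_eq_zero_iff_left (by norm_num)] at h2'
  rw [h2', Prod.snd_zero, zero_apply]

variable {V} in
/-- Degree `-2`: `T(0, ξ) ∈ V ⊕ 0` (the `V^* → V^*`-block vanishes). [cite: LooijengaLunts1997, §3 (3.1) p. 13 L46–L47] -/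
theorem snd_apply_inr_eq_zero_of_lie_gradingElement_eq_neg_two_smul {T : Module.End ℝ (sumDual V)}
    (h : ⁅gradingElement V, T⁆ = (-2 : ℝ) • T) (ξ : V →L[ℝ] ℝ) : (T (0, ξ)).2 = 0 := by
  refine ContinuousLinearMap.ext fun y ↦ ?_
  have h4 := (smul_blocks_eq_zero_of_lie_gradingElement_eq_smul h).2.2.2 ξ y
  rw [mul_eq_zero_iff_left (by norm_num)] at h4
  rw [h4, zero_apply]

variable {V} in
/-- Skewness of `T ∈ 𝔰𝔬(V ⊕ V^*)` on `V ⊕ 0`: the `V → V^*`-block `C` is alternating, `(Cx)(y) = -(Cy)(x)`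
("`C = ᵗC^†`" with the sign conventions of the split form). [cite: LooijengaLunts1997, §3 (3.1) p. 13 L43–L49, p. 15 L88–L95] -/
theorem snd_apply_inl_apply_comm_of_mem_so {T : Module.End ℝ (sumDual V)} (hT : T ∈ so V) (x y : V) :
    (T (x, 0)).2 y = -((T (y, 0)).2 x) := by
  have h := (mem_so_iff V T).1 hT (x, 0) (y, 0)
  simpa [splitForm_apply] using h

variable {V} in
/-- Skewness of `T ∈ 𝔰𝔬(V ⊕ V^*)` on `0 ⊕ V^*`: the `V^* → V`-block `B` is alternating, `θ(Bξ) = -ξ(Bθ)`.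
[cite: LooijengaLunts1997, §3 (3.1) p. 13 L43–L49, p. 15 L88–L95] -/
theorem apply_fst_apply_inr_comm_of_mem_so {T : Module.End ℝ (sumDual V)} (hT : T ∈ so V) (ξ θ : V →L[ℝ] ℝ) :
    θ (T (0, ξ)).1 = -(ξ (T (0, θ)).1) := by
  have h := (mem_so_iff V T).1 hT (0, ξ) (0, θ)
  simpa [splitForm_apply] using h

/-! ### §3 `u` simple in `𝔰𝔬(V ⊕ V^*)` forces a symplectic form on `V`: `dim V` is even -/

variable [FiniteDimensional ℝ V]

variable {V} in
/-- **If `u = [e, f]` for an `𝔰𝔩₂`-triple `(e, u, f)` in `𝔰𝔬(V ⊕ V^*)`, then `dim V` is even.**  Indeed `e ∈ 𝔤_2` is a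
block `C : V → V^*`, `f ∈ 𝔤_{-2}` a block `B : V^* → V`, and `[e, f] = u = (-1_V, 1_{V^*})` says `BC = 1_V`
(`CB = 1_{V^*}`); `C` is alternating by skewness, so `(x, y) ↦ (Cx)(y)` is a non-degenerate alternating form on `V`.
This is the mechanism behind "(D_{2m}, A_{2m-1}) (m ≥ 2)" / "in case D_{2l+1} any end of the Dynkin diagram … These
additional possibilities disappear if we want h to be a simple element (that is, h = [e,f] for certain e ∈ 𝔤_2
and f ∈ 𝔤_{-2})" and "the d_i's must all be even in the orthogonal cases with odd parity" (`V ⊕ V^*` has the odd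
`u`-degrees `∓1`, `d_0 = dim V`). [cite: LooijengaLunts1997, §2 (2.6) p. 10 L27, L31–L37; §1 p. 8 L78–L83, L96–L98; §3 (3.1) p. 13 L46–L47] -/
theorem even_finrank_of_isSl2Triple_gradingElement {e f : so V}
    (t : IsSl2Triple (⟨gradingElement V, gradingElement_mem_so V⟩ : so V) e f) : Even (finrank ℝ V) := by
  have he : ⁅gradingElement V, (e : Module.End ℝ (sumDual V))⁆ = (2 : ℝ) • (e : Module.End ℝ (sumDual V)) :=
    congrArg Subtype.val (mem_adDegree_iff.1 (e_mem_adDegree (K := ℝ) t))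
  have hf : ⁅gradingElement V, (f : Module.End ℝ (sumDual V))⁆ = (-2 : ℝ) • (f : Module.End ℝ (sumDual V)) :=
    congrArg Subtype.val (mem_adDegree_iff.1 (f_mem_adDegree (K := ℝ) t))
  have hEF : ⁅(e : Module.End ℝ (sumDual V)), (f : Module.End ℝ (sumDual V))⁆ = gradingElement V :=
    congrArg Subtype.val t.lie_e_f
  -- the blocks `C x = (e(x,0)).2`, `B ξ = (f(0,ξ)).1`
  have hex : ∀ x : V, (e : Module.End ℝ (sumDual V)) (x, 0) = (0, ((e : Module.End ℝ (sumDual V)) (x, 0)).2) :=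
    fun x ↦ Prod.ext (fst_apply_inl_eq_zero_of_lie_gradingElement_eq_two_smul he x) rfl
  have hfx : ∀ x : V, (f : Module.End ℝ (sumDual V)) (x, 0) = 0 :=
    apply_inl_eq_zero_of_lie_gradingElement_eq_neg_two_smul hf
  -- `B (C x) = x`
  have hBC : ∀ x : V, ((f : Module.End ℝ (sumDual V)) (0, ((e : Module.End ℝ (sumDual V)) (x, 0)).2)).1 = x :=
    fun x ↦ by
    have hv := LinearMap.congr_fun hEF (x, 0)
    rw [Ring.lie_def, LinearMap.sub_apply, Module.End.mul_apply, Module.End.mul_apply, hfx x, map_zero, zero_sub,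
      gradingElement_apply] at hv
    have h1 := congrArg Prod.fst hv
    rw [Prod.fst_neg, neg_inj, hex x] at h1
    exact h1
  -- the alternating form `β(x, y) = (C x)(y)`
  let β : LinearMap.BilinForm ℝ V :=
    (ContinuousLinearMap.coeLM ℝ) ∘ₗ (LinearMap.snd ℝ V (V →L[ℝ] ℝ)) ∘ₗ (e : Module.End ℝ (sumDual V)) ∘ₗ
      (LinearMap.inl ℝ V (V →L[ℝ] ℝ))
  have hβ : ∀ x y : V, β x y = ((e : Module.End ℝ (sumDual V)) (x, 0)).2 y := fun x y ↦ rfl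
  have hskew : ∀ x y : V, β x y = -β y x := fun x y ↦ by
    rw [hβ, hβ]; exact snd_apply_inl_apply_comm_of_mem_so e.2 x y
  have halt : β.IsAlt := fun x ↦ by
    have h := hskew x x
    linarith
  have hsep : ∀ x : V, (∀ y, β x y = 0) → x = 0 := fun x hx ↦ by
    have hC : ((e : Module.End ℝ (sumDual V)) (x, 0)).2 = 0 := ContinuousLinearMap.ext fun y ↦ by
      rw [← hβ]; exact hx y
    rw [← hBC x, hC, Prod.mk_zero_zero, map_zero, Prod.fst_zero]
  have hnd : β.Nondegenerate :=
    ⟨fun x hx ↦ hsep x hx, fun y hy ↦ hsep y fun x ↦ by rw [hskew, hy x, neg_zero]⟩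
  exact Literature.GroupTheory.FiniteAbelian.even_finrank_of_isAlt_of_nondegenerate halt hnd

/-- **`u` is a simple element of `𝔰𝔬(V ⊕ V^*)` only if `dim V` is even.** [cite: LooijengaLunts1997, §2 (2.6) p. 10 L31–L37; §1 p. 8 L96–L98] -/
theorem even_finrank_of_isSimpleElement_gradingElement
    (hs : IsSimpleElement (⟨gradingElement V, gradingElement_mem_so V⟩ : so V)) : Even (finrank ℝ V) := by
  obtain ⟨_, _, t⟩ := hs
  exact even_finrank_of_isSl2Triple_gradingElement t

/-- **For `dim V` odd, `(𝔰𝔬(V ⊕ V^*), u)` is not a Lefschetz pair** (no Lefschetz triple `(𝔰𝔬(V ⊕ V^*), u, 𝔞)`: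
its `h` would be simple) — the case `D_{2l+1}` excluded from (2.6). [cite: LooijengaLunts1997, §2 (2.6) p. 10 L20–L37; §1 p. 7 L54–L78] -/
theorem not_isLefschetzPair_so_of_odd (hodd : Odd (finrank ℝ V)) :
    ¬ IsLefschetzPair ℝ (⟨gradingElement V, gradingElement_mem_so V⟩ : so V) := by
  rintro ⟨𝔞, T⟩
  exact Nat.not_even_iff_odd.2 hodd (even_finrank_of_isSimpleElement_gradingElement V T.isSimpleElement)

/-- For `dim V` odd, `(𝔰𝔬(V ⊕ V^*), u)` is not a Jordan–Lefschetz pair. [cite: LooijengaLunts1997, §2 (2.6) p. 10 L20–L37] -/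
theorem not_isJordanLefschetzPair_so_of_odd (hodd : Odd (finrank ℝ V)) :
    ¬ IsJordanLefschetzPair ℝ (⟨gradingElement V, gradingElement_mem_so V⟩ : so V) :=
  fun J ↦ not_isLefschetzPair_so_of_odd V hodd J.isLefschetzPair

end Literature.LinearAlgebra.Alternating

/-! ### §4 The elliptic curve: for `dim_ℂ V = 1`, `(𝔰𝔬(V ⊕ V^*), u) = (𝔰𝔬(2,2), u)` is not a Lefschetz pair -/

namespace Literature.Geometry.Kaehler.ComplexTorus

open Module Function Literature.Algebra.Lie Literature.LinearAlgebra.Alternating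

variable (E : Type*) [NormedAddCommGroup E] [NormedSpace ℂ E] [FiniteDimensional ℂ E]

/-- For `dim_ℝ V = 2`: **`dim 𝔰𝔬(V ⊕ V^*)_2 ≤ 1`** (`𝔰𝔬(V ⊕ V^*)_2 ≅ ∧²V^*` via the alternating block `C`; an
alternating form on a plane is determined by one value `(C b₀)(b₁)`). [cite: LooijengaLunts1997, §3 (3.1) p. 13 L49–L57 ("ψ_2 : ∧²V^* → 𝔰𝔬(V ⊕ V^*)_2")] -/
theorem finrank_adDegree_two_so_le_one (h1 : finrank ℂ E = 1) :
    finrank ℝ (adDegree ℝ (⟨gradingElement E, gradingElement_mem_so E⟩ : so E) 2) ≤ 1 := by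
  have h2 : finrank ℝ E = 2 := by rw [finrank_real_of_complex, h1]
  let b : Module.Basis (Fin 2) ℝ E := Module.finBasisOfFinrankEq ℝ E h2
  set u : so E := ⟨gradingElement E, gradingElement_mem_so E⟩ with hu
  -- the functional `Θ T = (C_T b₀)(b₁)`
  let Θ : adDegree ℝ u 2 →ₗ[ℝ] ℝ :=
    { toFun := fun T ↦ (((T : so E) : Module.End ℝ (sumDual E)) (b 0, 0)).2 (b 1)
      map_add' := fun T S ↦ by
        simp only [AddMemClass.coe_add, LinearMap.add_apply, Prod.snd_add, add_apply]
      map_smul' := fun c T ↦ by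
        simp only [SetLike.val_smul, LinearMap.smul_apply, Prod.smul_snd, smul_apply, smul_eq_mul, RingHom.id_apply] }
  have hΘ : Injective Θ := by
    refine (injective_iff_map_eq_zero Θ).2 fun T hT ↦ ?_
    set T' : Module.End ℝ (sumDual E) := ((T : so E) : Module.End ℝ (sumDual E)) with hT'
    have hdeg : ⁅gradingElement E, T'⁆ = (2 : ℝ) • T' := congrArg Subtype.val (mem_adDegree_iff.1 T.2)
    have hso : T' ∈ so E := (T : so E).2
    -- the alternating form `β(x, y) = (C_T x)(y)` vanishes on the basis, hence everywhere
    let β : LinearMap.BilinForm ℝ E :=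
      (ContinuousLinearMap.coeLM ℝ) ∘ₗ (LinearMap.snd ℝ E (E →L[ℝ] ℝ)) ∘ₗ T' ∘ₗ (LinearMap.inl ℝ E (E →L[ℝ] ℝ))
    have hβ : ∀ x y : E, β x y = (T' (x, 0)).2 y := fun x y ↦ rfl
    have hskew : ∀ x y : E, β x y = -β y x := fun x y ↦ by
      rw [hβ, hβ]; exact snd_apply_inl_apply_comm_of_mem_so hso x y
    have halt : ∀ x : E, β x x = 0 := fun x ↦ by
      have h := hskew x x
      linarith
    have h01 : β (b 0) (b 1) = 0 := hT
    have hβ0 : β = 0 := by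
      refine LinearMap.BilinForm.ext_basis b fun i j ↦ ?_
      rw [LinearMap.zero_apply, LinearMap.zero_apply]
      revert i j
      rw [Fin.forall_fin_two, Fin.forall_fin_two, Fin.forall_fin_two]
      exact ⟨⟨halt _, h01⟩, by rw [hskew, h01, neg_zero], halt _⟩
    have hC : ∀ x : E, (T' (x, 0)).2 = 0 := fun x ↦ ContinuousLinearMap.ext fun y ↦ by
      rw [← hβ, hβ0]; rfl
    have hT'0 : T' = 0 := by
      refine LinearMap.ext fun v ↦ ?_
      have hv : v = (v.1, 0) + (0, v.2) := by ext <;> simp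
      rw [hv, map_add, apply_inr_eq_zero_of_lie_gradingElement_eq_two_smul hdeg, add_zero, LinearMap.zero_apply]
      exact Prod.ext (fst_apply_inl_eq_zero_of_lie_gradingElement_eq_two_smul hdeg v.1) (hC v.1)
    exact Subtype.ext (Subtype.ext hT'0)
  calc finrank ℝ (adDegree ℝ u 2) ≤ finrank ℝ ℝ := LinearMap.finrank_le_finrank_of_injective hΘ
    _ = 1 := finrank_self ℝ

/-- For `dim_ℝ V = 2`: **`dim 𝔰𝔬(V ⊕ V^*)_{-2} ≤ 1`** (`𝔰𝔬(V ⊕ V^*)_{-2} ≅ ∧²V` via the alternating block `B`).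
[cite: LooijengaLunts1997, §3 (3.1) p. 13 L49–L57 ("ψ_{−2} : ∧²V → 𝔰𝔬(V ⊕ V^*)_{−2}")] -/
theorem finrank_adDegree_neg_two_so_le_one (h1 : finrank ℂ E = 1) :
    finrank ℝ (adDegree ℝ (⟨gradingElement E, gradingElement_mem_so E⟩ : so E) (-2)) ≤ 1 := by
  have h2 : finrank ℝ E = 2 := by rw [finrank_real_of_complex, h1]
  let b : Module.Basis (Fin 2) ℝ E := Module.finBasisOfFinrankEq ℝ E h2
  have h2' : finrank ℝ (E →L[ℝ] ℝ) = 2 := by rw [finrank_dual_eq, h2]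
  let d : Module.Basis (Fin 2) ℝ (E →L[ℝ] ℝ) := Module.finBasisOfFinrankEq ℝ (E →L[ℝ] ℝ) h2'
  set u : so E := ⟨gradingElement E, gradingElement_mem_so E⟩ with hu
  let Θ : adDegree ℝ u (-2) →ₗ[ℝ] ℝ :=
    { toFun := fun T ↦ d 1 (((T : so E) : Module.End ℝ (sumDual E)) (0, d 0)).1
      map_add' := fun T S ↦ by
        simp only [AddMemClass.coe_add, LinearMap.add_apply, Prod.fst_add, map_add]
      map_smul' := fun c T ↦ by
        simp only [SetLike.val_smul, LinearMap.smul_apply, Prod.smul_fst, map_smul, smul_eq_mul, RingHom.id_apply] }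
  have hΘ : Injective Θ := by
    refine (injective_iff_map_eq_zero Θ).2 fun T hT ↦ ?_
    set T' : Module.End ℝ (sumDual E) := ((T : so E) : Module.End ℝ (sumDual E)) with hT'
    have hdeg : ⁅gradingElement E, T'⁆ = (-2 : ℝ) • T' := congrArg Subtype.val (mem_adDegree_iff.1 T.2)
    have hso : T' ∈ so E := (T : so E).2
    -- the alternating form `γ(ξ, θ) = θ(B_T ξ)` on `V^*` vanishes on the basis `d`, hence everywhere
    let γ : LinearMap.BilinForm ℝ (E →L[ℝ] ℝ) :=
      LinearMap.mk₂ ℝ (fun ξ θ : E →L[ℝ] ℝ ↦ θ (T' (0, ξ)).1)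
        (fun ξ ξ' θ ↦ by
          rw [show ((0 : E), ξ + ξ') = ((0 : E), ξ) + ((0 : E), ξ') by rw [Prod.mk_add_mk, add_zero], map_add,
            Prod.fst_add, map_add])
        (fun c ξ θ ↦ by
          rw [show ((0 : E), c • ξ) = c • ((0 : E), ξ) by rw [Prod.smul_mk, smul_zero], map_smul, Prod.smul_fst,
            map_smul, smul_eq_mul])
        (fun ξ θ θ' ↦ by rw [add_apply])
        (fun c ξ θ ↦ by rw [smul_apply, smul_eq_mul])
    have hγ : ∀ ξ θ : E →L[ℝ] ℝ, γ ξ θ = θ (T' (0, ξ)).1 := fun ξ θ ↦ rfl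
    have hskew : ∀ ξ θ : E →L[ℝ] ℝ, γ ξ θ = -γ θ ξ := fun ξ θ ↦ by
      rw [hγ, hγ]; exact apply_fst_apply_inr_comm_of_mem_so hso ξ θ
    have halt : ∀ ξ : E →L[ℝ] ℝ, γ ξ ξ = 0 := fun ξ ↦ by
      have h := hskew ξ ξ
      linarith
    have h01 : γ (d 0) (d 1) = 0 := hT
    have hγ0 : γ = 0 := by
      refine LinearMap.BilinForm.ext_basis d fun i j ↦ ?_
      rw [LinearMap.zero_apply, LinearMap.zero_apply]
      revert i j
      rw [Fin.forall_fin_two, Fin.forall_fin_two, Fin.forall_fin_two]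
      exact ⟨⟨halt _, h01⟩, by rw [hskew, h01, neg_zero], halt _⟩
    have hB : ∀ ξ : E →L[ℝ] ℝ, (T' (0, ξ)).1 = 0 := fun ξ ↦ by
      refine (b.forall_coord_eq_zero_iff).1 fun i ↦ ?_
      have h := hγ ξ ((b.coord i).toContinuousLinearMap)
      rw [hγ0, LinearMap.zero_apply, LinearMap.zero_apply] at h
      rw [← LinearMap.coe_toContinuousLinearMap' (b.coord i)]
      exact h.symm
    have hT'0 : T' = 0 := by
      refine LinearMap.ext fun v ↦ ?_
      have hv : v = (v.1, 0) + (0, v.2) := by ext <;> simp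
      rw [hv, map_add, apply_inl_eq_zero_of_lie_gradingElement_eq_neg_two_smul hdeg, zero_add, LinearMap.zero_apply]
      exact Prod.ext (hB v.2) (snd_apply_inr_eq_zero_of_lie_gradingElement_eq_neg_two_smul hdeg v.2)
    exact Subtype.ext (Subtype.ext hT'0)
  calc finrank ℝ (adDegree ℝ u (-2)) ≤ finrank ℝ ℝ := LinearMap.finrank_le_finrank_of_injective hΘ
    _ = 1 := finrank_self ℝ

/-- **The elliptic curve: for `dim_ℂ V = 1`, `(𝔰𝔬(V ⊕ V^*), u) = (𝔰𝔬(2,2), u)` is NOT a Lefschetz pair.**  A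
Lefschetz triple `(𝔰𝔬(V ⊕ V^*), u, 𝔞)` would be Jordan–Lefschetz (`𝔤_4(u) = 0`, rows A1-109/A1-211), hence
`dim 𝔰𝔬(V ⊕ V^*) ≤ dim 𝔤_{-2} + dim 𝔤_0 + dim 𝔤_2 ≤ 3` (§1, §4), but `dim_ℝ 𝔰𝔬(V ⊕ V^*) = 2 · 3 = 6`: `𝔤_2 ⊕ 𝔤_{-2}`
generates only the `𝔰𝔩₂ = 𝔤_tot(X; ℝ) ⊊ 𝔰𝔬(2,2)` of row A1-43 (`totalLieAlgebra_eq_toLieSubalgebra`).  This is the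
bound "`m ≥ 2`" of "(D_{2m}, A_{2m−1}) (m ≥ 2)" in (2.6) for the real form (3.3).
[cite: LooijengaLunts1997, §2 (2.6) p. 10 L27–L29; §3 (3.3) p. 13 L110–L112; §1 p. 7 L54–L78] -/
theorem not_isLefschetzPair_so_of_finrank_eq_one (h1 : finrank ℂ E = 1) :
    ¬ IsLefschetzPair ℝ (⟨gradingElement E, gradingElement_mem_so E⟩ : so E) := by
  rintro ⟨𝔞, T⟩
  have J := T.isJordanLefschetzPair_of_adDegree_four_eq_bot
    (adDegree_so_gradingElement_eq_bot E (by norm_num) (by norm_num) (by norm_num))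
  have h3 := J.finrank_le_three (finrank_adDegree_two_so_le_one E h1) (finrank_adDegree_neg_two_so_le_one E h1)
  rw [finrank_so, finrank_real_of_complex, h1] at h3
  norm_num at h3

/-- For `dim_ℂ V = 1`, `(𝔰𝔬(V ⊕ V^*), u)` is not a Jordan–Lefschetz pair. [cite: LooijengaLunts1997, §2 (2.6) p. 10 L27–L29; §3 (3.3)] -/
theorem not_isJordanLefschetzPair_so_of_finrank_eq_one (h1 : finrank ℂ E = 1) :
    ¬ IsJordanLefschetzPair ℝ (⟨gradingElement E, gradingElement_mem_so E⟩ : so E) :=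
  fun J ↦ not_isLefschetzPair_so_of_finrank_eq_one E h1 J.isLefschetzPair

/-- **On complex tori, `(𝔰𝔬(V ⊕ V^*), u)` is a Jordan–Lefschetz pair iff `g = dim_ℂ V ≥ 2`** (row A1-211
`isJordanLefschetzPair_so` for `g ≥ 2`; `g = 1` above). [cite: LooijengaLunts1997, §3 (3.3) p. 13 L110–L112; §2 (2.6) p. 10 L27–L29 ("(D_{2m}, A_{2m−1}) (m ≥ 2)")] -/
theorem isJordanLefschetzPair_so_iff [Nontrivial E] :
    IsJordanLefschetzPair ℝ (⟨gradingElement E, gradingElement_mem_so E⟩ : so E) ↔ 2 ≤ finrank ℂ E := by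
  refine ⟨fun J ↦ ?_, isJordanLefschetzPair_so E⟩
  by_contra hlt
  have h1 : finrank ℂ E = 1 := by
    have := Module.finrank_pos (R := ℂ) (M := E)
    omega
  exact not_isJordanLefschetzPair_so_of_finrank_eq_one E h1 J

/-- `(𝔰𝔬(V ⊕ V^*), u)` is a Lefschetz pair iff `g ≥ 2`. [cite: LooijengaLunts1997, §3 (3.3) p. 13 L110–L112; §2 (2.6) p. 10 L27–L29] -/
theorem isLefschetzPair_so_iff [Nontrivial E] :
    IsLefschetzPair ℝ (⟨gradingElement E, gradingElement_mem_so E⟩ : so E) ↔ 2 ≤ finrank ℂ E := by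
  refine ⟨fun P ↦ ?_, fun h2 ↦ isLefschetzPair_so E h2⟩
  by_contra hlt
  have h1 : finrank ℂ E = 1 := by
    have := Module.finrank_pos (R := ℂ) (M := E)
    omega
  exact not_isLefschetzPair_so_of_finrank_eq_one E h1 P

end Literature.Geometry.Kaehler.ComplexTorus
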